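import Literature.MathematicalPhysics.QuantumFieldTheory.Balaban1983to89.Node00.N24NodesStage12PointedAll
import Literature.MathematicalPhysics.QuantumFieldTheory.Balaban1983to89.Node00.N24NodesStage12FourPinPointed
import Literature.MathematicalPhysics.QuantumFieldTheory.Balaban1983to89.Node00.N24KnitStage12Carriers

/-!
# NODE N24 · (B2) AND CRUX K1′'s STUB BODIES AT NODE 00's FOUR-PIN STAGE-12 CARRIER CHAIN `IsRecordOfRecord₁₂CB10YZW → ₁₂C` WITH EVERY STAGE-12-NATIVE CHILD ENTERED BY NAME —
# module 17's recipe at Stage 12 (module 25 `N24KnitStage12Carriers`, module 29 `N24NodesStage12FourPinPointed`) with the last by-name binders `h09` ∕ `h11` and the world-level pair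
# `hR` + `hcor3` replaced by the θ-keyed junctions of N09 (module 28a), N11 (seat dag-n11-e) and N13 (module 30 `B16NodeKnitRecord12`)

TRACK A (YM-PLAN §2d, node N24 of 28 = binder B2 `hB : B16.EndStatementBPrinted D.C`), seat `pub-ymgap-dag-n24-c` (R134 fan-out seat, strategy s2 «`N24_at_record…_knit_all_carriers_pinned`
(module 17 recipe)»; gen 3; g2 HANDOFF trigger (t2)).  THIRTY-THIRD N24 module, a NEW importing one (modules 1–32 untouched; imports module 32 `N24NodesStage12PointedAll`, module 29
`N24NodesStage12FourPinPointed`, module 25 `N24KnitStage12Carriers`).  THEOREMS ONLY, def-free, sorry-free, standard axioms.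

THE FOUR-PIN RECORD (node00-def lineage, `Node00/Record12Carriers` ∕ `Record12CarriersRecords`): `IsRecordOfRecord₁₂CB10YZW F N D w` = def-T's `IsRecordOfRecord₁₂C` VERBATIM with the
upstream block the C-binding at the view `θ.view₁₂B10YZW F N M⋆ ops ζ λW` ([B10] runs pinned; the [B9] group at def-Y's `Y9OfRecord` over a residual operator layer `ops`; the [B11]
group at `Z11OfRecord ζ`; the [IV] group at `WOfRecord₁₂ θ λW`); it REFINES `₁₂C` with the SAME `(D, w)` (`isRecordOfRecord₁₂C_of_isRecordOfRecord₁₂CB10YZW`), so every θ-keyed junction over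
₁₂C presentations — N05's [B8] socket, N09's four inputs, N10's B13 socket, N11's (S1ᵀ), N13's (R₁₂) + (UV₁₂) — transfers in one line, while N06 ∕ N07 ∕ N12 are read at the pinned
layers (node00-def's `b9_b11_b15_main_of_isRecordOfRecord₁₂CB10YZW_of_slots`) and N08 at THE PRINTED SENTENCE `PrintedUV3V N L` at the world's odd block size (module 25's
`N24_b10_main_of_isRecordOfRecord₁₂CB10YZW_of_printedUV3V`).  In the POINTED form (a world bound to the view of `(θ, hP)` at CHOSEN layers) the world's 𝐑-leaf is STILL θ's repaired
R-law (module 29's `N24_rOperation_iff_of_up_view₁₂B10YZW`: the pins never touch the 𝐑-carrier), so N13 enters through dag-n13-a's construction-generic engine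
`B16NodeKnitRepTowerOfRecord.b16_main_at_repTowerOfRecord_along` at `coreOfRecord₁₂ θ` with that pin reading — module 30's `b16_main_at_record₁₂`, whose pin reading is keyed on
`θ.toStage5₁₂`, is the same one-liner at the bare view.

WHAT THIS FILE PROVES.
§1 AT `IsRecordOfRecord₁₂CB10YZW` (keyed): **`N24_at_record₁₂CB10YZW_knit_all_carriers_all_pinned`** — (B2): N08 ← `PrintedUV3V N L`; N06 ∧ N07 ∧ N12 ← «for every presenting
   `(θ, h, M⋆, ops, ζ, λW)`: def-Y's leaf `B9LeafX (Y9OfRecord N θ₃ M⋆ ops)` ∧ `B11Leaf (Z11OfRecord F N ζ)` ∧ `∀ P, B15Leaf (WOfRecord₁₂ θ λW P)`» (HIDDEN residual layers — junk-closable,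
   location-positive, strength-neutral, not bookable in ∀-form; module 25's honesty note); N05 ∕ N10 θ-keyed sockets; **N09** ← `slot12` + [B11] Thm 1 ×3; **N11** ← `slot11`; **N13** ←
   `slots₁₃`; β-box.  `N24_nodes₁₂CB10YZW_knit_all_carriers_all_pinned` — the thirteen-node conjunction AT `w` from the same list without the β-box.
§2 POINTED over the four-pin view (module 29 §1–§2 with `hcor3` ↦ (UV₁₂)): **`N24_nodes₁₂B10YZW_pointed_all`**, `N24_nodesAtSomeRecord₁₂_of_fourPin_pointed_all`,
   `N24_betaWindowAtSomeRecord₁₂_of_fourPin_pointed_all_of_boxH`, **`N24_stabilityBR12e_thetaShape15_fourPin_pointed_all`**.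

WHICH CHILD BLOCKS OVER THE FOUR-PIN CHAIN AFTER THIS FILE (kernel form): N05 [B8] residual leaf at `θ.res.X` · N06 def-Y's leaf at the (hidden ∕ chosen) layer `(M⋆, ops)` · N07 [B11] leaf at
`ζ` · N08 the PRINTED `PrintedUV3V N L` · N09 Lemma-4 leaf + [B11] Thm 1 ×3 · N10 B13 socket · N11 (S1ᵀ) · N12 [IV] leaf at `λW` · N13 (R₁₂) law transport + (UV₁₂) (0.1) pointwise on
`densOfRecord₁₀ θ.toStage9Params` · guard + `Provisos₁₂ ∧ Admissible` = K0′ `Record12Inhabited` (stmt-QuantumFields-19902; the chain is inhabited iff ₁₂C is) · β⁺ ([I] (1.22) p. 264) +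
`b > 0` (NODE O, UNPRINTED).  NO WORLD-LEVEL NODE HYPOTHESIS, NO PURE NODE BINDER.
HONEST FRAMING: kernel bookkeeping BY NAME; nothing of Bałaban's asserted; every slot DISPLAYED; N24 COMPOSITE — no discharge, no count, no stub closed; one finite T⁴ programme at
fixed ε; NOT continuum ∕ ℝ⁴ ∕ OS ∕ mass gap ∕ Clay.
-/

noncomputable section

open scoped Matrix.Norms.L2Operator

namespace Literature.MathematicalPhysics.QuantumFieldTheory.Balaban1983to89.Node00

open DagBinding T4Continuum T4DatumAssembly FlowStepRuns AveragingRT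
open FlowStep (BetaLowerH BetaUpperH)

variable {F : T4Family} {N : ℕ} [NeZero N] {D : FiniteEpsData F (SU N)} {w : WorldP}

/-! ## §1. At the four-pin Stage-12 record `IsRecordOfRecord₁₂CB10YZW`, every child by name -/

/-- **N24 · (B2) AT THE FOUR-PIN STAGE-12 RECORD, THE PINNED CHILDREN AT THEIR STATEMENTS OF RECORD AND EVERY OTHER CHILD BY NAME** (module 25's
`N24_at_record₁₂CB10YZW_knit_all_carriers_pinned` with `h09` ↦ `slot12` + `h11dom` + `hres` + `huniq`, `h11` ↦ `slot11`, `hR` + `hcor3` ↦ `slots₁₃`): **N08** ← the printed slot `PrintedUV3V N L` at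
the world's odd block size `L > 1`; **N06 ∧ N07 ∧ N12** ← «for every `(θ, h, M⋆, ops, ζ, λW)` presenting the record: `B9LeafX (Y9OfRecord N θ.toStage3Params M⋆ ops)` ∧ `B11Leaf (Z11OfRecord F N ζ)`
∧ `∀ P, B15Leaf (WOfRecord₁₂ F N θ λW P)`» (HONEST: hidden residual layers, junk-closable; location-positive, strength-neutral); **N05**, **N10** θ-keyed sockets over `θ.toStage5₁₂` (every ₁₂C
presentation, the pinned one included); **N09** own Lemma-4 leaf + [Balaban1985Variational] Thm 1 ×3 (`B12NodeKnitRecord12`); **N11** (S1ᵀ) (`B14NodeKnitRecord12R`); **N13** (R₁₂) + (UV₁₂)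
(`B16NodeKnitRecord12`); β-box on `D.βfun`.  WHICH CHILD BLOCKS at `₁₂CB10YZW`, kernel form: the hypothesis list — no pure node binder, no world-level node hypothesis.
[cite: Balaban1989LargeFieldII, Thm 1 p.355, (0.1) pp.355–356, p.387, p.391; Balaban1985UV3, (1)–(5) p.256, Thm 1 p.257 + Thm 2 p.272; Balaban1985BackgroundPropagators, Thms 3.1–3.15 pp.397–432; Balaban1985Variational, Thm 1 (8)–(10) p.279, Props 2–9 pp.281–309; Balaban1988Convergent, Thm 1 p.262, Theorem p.245, Thm 2 p.263, p.244, (2.18) p.257, Cor. 3 (2.50) p.264; Balaban1987RG1, Thm 1 p.259, Thm 3 p.264, Lemma 4 (3.53) p.280, (1.1)–(1.3) p.260, (1.22) p.264; Balaban1985RegularSpaces, Thms 2, 4, 8 pp.83–101; Balaban1988RG2Cluster, Lemmas 1–3 pp.9, 11, 20; Balaban1989LargeFieldI, Prop. 1 p.194 (bookkeeping over the carrier-pinned Stage-12 record)] -/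
theorem N24_at_record₁₂CB10YZW_knit_all_carriers_all_pinned (h : IsRecordOfRecord₁₂CB10YZW F N D w) {γ₀ : ℝ} (hγ₀ : w.γ ≤ γ₀)
    (slots₀₅ : ∀ (θ : Stage12Params F N) (hP : θ.Provisos₁₂ F N), θ.Admissible F N → D = datumOfRecord₁₂ F N θ hP →
      (∀ P, w.up P = upOfRecord₅C F N (θ.toStage5₁₂ F N) P) → ∀ P : B12.RunParams,
        B8LeafR (θ.res.X P).d8 (θ.res.X P).L8 (θ.res.X P).C₂ (θ.res.X P).B₁' (θ.res.X P).B₀' (θ.res.X P).B₁ (θ.res.X P).B₂ (θ.res.X P).c₁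
          (θ.res.X P).inp8 (θ.res.X P).B₀β (θ.res.X P).loc8 (θ.res.X P).fam8R (θ.res.X P).lan8 (θ.res.X P).cub8 (θ.res.X P).toAxial8)
    (hYZW : ∀ (θ : Stage12Params F N) (hP : θ.Provisos₁₂ F N) (Mstar : ℕ) (ops : OpsY N θ.toStage3Params Mstar) (ζ : ResidZ F N) (lamW : ResidW F N),
      θ.Admissible F N → D = datumOfRecord₁₂ F N θ hP → (∀ P, w.up P = upOfRecord₅C F N (θ.view₁₂B10YZW F N Mstar ops ζ lamW) P) →
        B9LeafX (Y9OfRecord N θ.toStage3Params Mstar ops) ∧ B11Leaf (Z11OfRecord F N ζ) ∧ ∀ P : B12.RunParams, B15Leaf (WOfRecord₁₂ F N θ lamW P))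
    (hUV₀₈ : ∀ L : ℕ, Odd L → 1 < L → w.L = (L : ℝ) → PrintedUV3V N L)
    (slot12 : ∀ (θ : Stage12Params F N) (hP : θ.Provisos₁₂ F N), θ.Admissible F N → D = datumOfRecord₁₂ F N θ hP → w.γ ≤ θ.γ →
      (∀ P, w.up P = upOfRecord₅C F N (θ.toStage5₁₂ F N) P) → ∀ P : B12.RunParams, B12Sec2to5.Lemma4Printed (θ.res.X P).F12 (θ.res.X P).c12)
    (h11dom : ∀ (θ : Stage12Params F N) (hP : θ.Provisos₁₂ F N), θ.Admissible F N → D = datumOfRecord₁₂ F N θ hP → w.γ ≤ θ.γ →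
      ∀ (p : B12.RunParams) (k : ℕ), k ≤ p.K →
        ∀ V ∈ domAltOfRecord F N θ.ν p.K k, UkExists F N p.K k θ.εbg V ∧ UniqueUkOrbit F N p.K k θ.εbg V)
    (hres : ∀ (θ : Stage12Params F N) (hP : θ.Provisos₁₂ F N), θ.Admissible F N → D = datumOfRecord₁₂ F N θ hP → w.γ ≤ θ.γ →
      ∀ (p : B12.RunParams) (k : ℕ), k ≤ p.K → HRestrict F N θ.εbg p.K k (domAltOfRecord F N θ.ν p.K k))
    (huniq : ∀ (θ : Stage12Params F N) (hP : θ.Provisos₁₂ F N), θ.Admissible F N → D = datumOfRecord₁₂ F N θ hP → w.γ ≤ θ.γ →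
      ∀ (p : B12.RunParams) (k : ℕ), k ≤ p.K → ∀ V ∈ domAltOfRecord F N θ.ν p.K k, ∀ j < k,
        UniqueUkOrbit F N p.K (j + 1) θ.εbg (Averaging.iter (avOfRecord F N p.K) (j + 1) (Uk F N p.K k θ.εbg V)))
    (slots₁₀ : ∀ (θ : Stage12Params F N) (hP : θ.Provisos₁₂ F N), θ.Admissible F N → D = datumOfRecord₁₂ F N θ hP →
      (∀ P, w.up P = upOfRecord₅C F N (θ.toStage5₁₂ F N) P) → ∀ P : B12.RunParams,
        B9LeafX (θ.res.Y P) →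
          (B10.Thm1PrintedCompact (θ.res.X P).runs10 ∧ B10.Thm2Printed (θ.res.X P).runs10) →
            B11Leaf (θ.res.Z P) → B12Sec2to5.Lemma4Printed (θ.res.X P).F12 (θ.res.X P).c12 →
              B13.Lemma1Printed (θ.res.X P).S13 (θ.res.X P).c13 ∧ B13.Lemma2Printed (θ.res.X P).S13 (θ.res.X P).c13 ∧
                B13.Lemma3Printed (θ.res.X P).S13 (θ.res.X P).c13)
    (slot11 : ∀ (θ : Stage12Params F N) (hP : θ.Provisos₁₂ F N), θ.Admissible F N → D = datumOfRecord₁₂ F N θ hP →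
      (∀ P, w.up P = upOfRecord₅C F N (θ.toStage5₁₂ F N) P) → ∀ P : B12.RunParams,
        (leavesP w P).b7 → (leavesP w P).b8 → (leavesP w P).b9 → (leavesP w P).b10 → (leavesP w P).b11 →
          (leavesP w P).smallCouplings → (leavesP w P).smallFieldInductive → (leavesP w P).flowControl →
            ∀ k, k < P.K → SLaw₁₂ F N θ P k → TLaw₁₂ F N θ P k)
    (slots₁₃ : ∀ (θ : Stage12Params F N) (hP : θ.Provisos₁₂ F N), θ.Admissible F N → D = datumOfRecord₁₂ F N θ hP →
      (∀ P, w.up P = upOfRecord₅C F N (θ.toStage5₁₂ F N) P) → ∀ P : B12.RunParams,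
        (∀ k, k < P.K → TLaw₁₂ F N θ P k → SLaw₁₂ F N θ P (k + 1)) ∧
        ((genFlow (betaOfRecord₁₀ F N θ.toStage9Params) P.g0).InInterval w.γ P.K → ∀ k, k ≤ P.K → SLaw₁₂ F N θ P k →
          ∀ U : GaugeField (F.P P.K) k (SU N),
            chiFixed7 F N θ.ν P.K (gOfRecord₁₀ F N θ.toStage9Params P) k U *
                  Real.exp (-(1 / (gOfRecord₁₀ F N θ.toStage9Params P k) ^ 2 * wilsonBGOfRecord F N θ.εbg P k U)
                    - w.em (gOfRecord₁₀ F N θ.toStage9Params P k) * (Fintype.card (Site (F.P P.K) k) : ℝ)) ≤ densOfRecord₁₀ F N θ.toStage9Params P k U ∧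
            densOfRecord₁₀ F N θ.toStage9Params P k U ≤ Real.exp (w.ep (gOfRecord₁₀ F N θ.toStage9Params P k) * (Fintype.card (Site (F.P P.K) k) : ℝ))))
    (hlo : BetaLowerH w.b γ₀ D.βfun) (hhi : BetaUpperH w.βup γ₀ D.βfun) :
    B16.EndStatementBPrinted D.C :=
  have h₁₂ := isRecordOfRecord₁₂C_of_isRecordOfRecord₁₂CB10YZW h
  have h3 := b9_b11_b15_main_of_isRecordOfRecord₁₂CB10YZW_of_slots h hYZW
  N24_at_record₁₂C h₁₂ hγ₀ (N24_b8_main_of_isRecordOfRecord₁₂C_of_slot h₁₂ slots₀₅) (fun P => (h3 P).1) (fun P => (h3 P).2.1)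
    (N24_b10_main_of_isRecordOfRecord₁₂CB10YZW_of_printedUV3V h hUV₀₈) (N24_b12_main_of_isRecordOfRecord₁₂C_of_slots h₁₂ slot12 h11dom hres huniq)
    (N24_b13_main_of_isRecordOfRecord₁₂C_of_slot h₁₂ slots₁₀) (N24_b14_main_of_isRecordOfRecord₁₂C_of_slot h₁₂ slot11) (fun P => (h3 P).2.2)
    (N24_b16_main_of_isRecordOfRecord₁₂C_of_slots h₁₂ slots₁₃) hlo hhi

/-- **N24 · THE THIRTEEN DAG NODES AT THE WORLD OF A FOUR-PIN STAGE-12 RECORD ITSELF, the pinned children at their statements of record and every other child by name** (§1's list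
WITHOUT the β-box — the nodes do not read it): the `stub_nodes12` consequent `∀ P, Nodes (leavesP w P)` over the four-pin chain, no exponent re-read.
[cite: Balaban1989LargeFieldII, Thm 1 p.355, (0.1) pp.355–356, p.387, p.391; Balaban1985UV3, Thm 1 p.257 + Thm 2 p.272; Balaban1985BackgroundPropagators, Thms 3.1–3.15 pp.397–432; Balaban1985Variational, Thm 1 (8)–(10) p.279; Balaban1988Convergent, Thm 1 p.262, Theorem p.245, p.244, Cor. 3 (2.50) p.264; Balaban1987RG1, Thm 1 p.259, Thm 3 p.264, Lemma 4 (3.53) p.280; Balaban1985RegularSpaces, Thms 2, 4, 8 pp.83–101; Balaban1988RG2Cluster, Lemmas 1–3 pp.9, 11, 20; Balaban1989LargeFieldI, Prop. 1 p.194; Balaban1983RegularityDecay, Theorem p.573; Balaban1984PropagatorsI, Props. 1.1–1.2 pp.33–36; Balaban1984PropagatorsII, pp.234–249; Balaban1985Averaging, Props. 1–10 pp.26–50 (bookkeeping over the carrier-pinned Stage-12 record)] -/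
theorem N24_nodes₁₂CB10YZW_knit_all_carriers_all_pinned (h : IsRecordOfRecord₁₂CB10YZW F N D w)
    (slots₀₅ : ∀ (θ : Stage12Params F N) (hP : θ.Provisos₁₂ F N), θ.Admissible F N → D = datumOfRecord₁₂ F N θ hP →
      (∀ P, w.up P = upOfRecord₅C F N (θ.toStage5₁₂ F N) P) → ∀ P : B12.RunParams,
        B8LeafR (θ.res.X P).d8 (θ.res.X P).L8 (θ.res.X P).C₂ (θ.res.X P).B₁' (θ.res.X P).B₀' (θ.res.X P).B₁ (θ.res.X P).B₂ (θ.res.X P).c₁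
          (θ.res.X P).inp8 (θ.res.X P).B₀β (θ.res.X P).loc8 (θ.res.X P).fam8R (θ.res.X P).lan8 (θ.res.X P).cub8 (θ.res.X P).toAxial8)
    (hYZW : ∀ (θ : Stage12Params F N) (hP : θ.Provisos₁₂ F N) (Mstar : ℕ) (ops : OpsY N θ.toStage3Params Mstar) (ζ : ResidZ F N) (lamW : ResidW F N),
      θ.Admissible F N → D = datumOfRecord₁₂ F N θ hP → (∀ P, w.up P = upOfRecord₅C F N (θ.view₁₂B10YZW F N Mstar ops ζ lamW) P) →
        B9LeafX (Y9OfRecord N θ.toStage3Params Mstar ops) ∧ B11Leaf (Z11OfRecord F N ζ) ∧ ∀ P : B12.RunParams, B15Leaf (WOfRecord₁₂ F N θ lamW P))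
    (hUV₀₈ : ∀ L : ℕ, Odd L → 1 < L → w.L = (L : ℝ) → PrintedUV3V N L)
    (slot12 : ∀ (θ : Stage12Params F N) (hP : θ.Provisos₁₂ F N), θ.Admissible F N → D = datumOfRecord₁₂ F N θ hP → w.γ ≤ θ.γ →
      (∀ P, w.up P = upOfRecord₅C F N (θ.toStage5₁₂ F N) P) → ∀ P : B12.RunParams, B12Sec2to5.Lemma4Printed (θ.res.X P).F12 (θ.res.X P).c12)
    (h11dom : ∀ (θ : Stage12Params F N) (hP : θ.Provisos₁₂ F N), θ.Admissible F N → D = datumOfRecord₁₂ F N θ hP → w.γ ≤ θ.γ →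
      ∀ (p : B12.RunParams) (k : ℕ), k ≤ p.K →
        ∀ V ∈ domAltOfRecord F N θ.ν p.K k, UkExists F N p.K k θ.εbg V ∧ UniqueUkOrbit F N p.K k θ.εbg V)
    (hres : ∀ (θ : Stage12Params F N) (hP : θ.Provisos₁₂ F N), θ.Admissible F N → D = datumOfRecord₁₂ F N θ hP → w.γ ≤ θ.γ →
      ∀ (p : B12.RunParams) (k : ℕ), k ≤ p.K → HRestrict F N θ.εbg p.K k (domAltOfRecord F N θ.ν p.K k))
    (huniq : ∀ (θ : Stage12Params F N) (hP : θ.Provisos₁₂ F N), θ.Admissible F N → D = datumOfRecord₁₂ F N θ hP → w.γ ≤ θ.γ →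
      ∀ (p : B12.RunParams) (k : ℕ), k ≤ p.K → ∀ V ∈ domAltOfRecord F N θ.ν p.K k, ∀ j < k,
        UniqueUkOrbit F N p.K (j + 1) θ.εbg (Averaging.iter (avOfRecord F N p.K) (j + 1) (Uk F N p.K k θ.εbg V)))
    (slots₁₀ : ∀ (θ : Stage12Params F N) (hP : θ.Provisos₁₂ F N), θ.Admissible F N → D = datumOfRecord₁₂ F N θ hP →
      (∀ P, w.up P = upOfRecord₅C F N (θ.toStage5₁₂ F N) P) → ∀ P : B12.RunParams,
        B9LeafX (θ.res.Y P) →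
          (B10.Thm1PrintedCompact (θ.res.X P).runs10 ∧ B10.Thm2Printed (θ.res.X P).runs10) →
            B11Leaf (θ.res.Z P) → B12Sec2to5.Lemma4Printed (θ.res.X P).F12 (θ.res.X P).c12 →
              B13.Lemma1Printed (θ.res.X P).S13 (θ.res.X P).c13 ∧ B13.Lemma2Printed (θ.res.X P).S13 (θ.res.X P).c13 ∧
                B13.Lemma3Printed (θ.res.X P).S13 (θ.res.X P).c13)
    (slot11 : ∀ (θ : Stage12Params F N) (hP : θ.Provisos₁₂ F N), θ.Admissible F N → D = datumOfRecord₁₂ F N θ hP →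
      (∀ P, w.up P = upOfRecord₅C F N (θ.toStage5₁₂ F N) P) → ∀ P : B12.RunParams,
        (leavesP w P).b7 → (leavesP w P).b8 → (leavesP w P).b9 → (leavesP w P).b10 → (leavesP w P).b11 →
          (leavesP w P).smallCouplings → (leavesP w P).smallFieldInductive → (leavesP w P).flowControl →
            ∀ k, k < P.K → SLaw₁₂ F N θ P k → TLaw₁₂ F N θ P k)
    (slots₁₃ : ∀ (θ : Stage12Params F N) (hP : θ.Provisos₁₂ F N), θ.Admissible F N → D = datumOfRecord₁₂ F N θ hP →
      (∀ P, w.up P = upOfRecord₅C F N (θ.toStage5₁₂ F N) P) → ∀ P : B12.RunParams,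
        (∀ k, k < P.K → TLaw₁₂ F N θ P k → SLaw₁₂ F N θ P (k + 1)) ∧
        ((genFlow (betaOfRecord₁₀ F N θ.toStage9Params) P.g0).InInterval w.γ P.K → ∀ k, k ≤ P.K → SLaw₁₂ F N θ P k →
          ∀ U : GaugeField (F.P P.K) k (SU N),
            chiFixed7 F N θ.ν P.K (gOfRecord₁₀ F N θ.toStage9Params P) k U *
                  Real.exp (-(1 / (gOfRecord₁₀ F N θ.toStage9Params P k) ^ 2 * wilsonBGOfRecord F N θ.εbg P k U)
                    - w.em (gOfRecord₁₀ F N θ.toStage9Params P k) * (Fintype.card (Site (F.P P.K) k) : ℝ)) ≤ densOfRecord₁₀ F N θ.toStage9Params P k U ∧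
            densOfRecord₁₀ F N θ.toStage9Params P k U ≤ Real.exp (w.ep (gOfRecord₁₀ F N θ.toStage9Params P k) * (Fintype.card (Site (F.P P.K) k) : ℝ)))) :
    ∀ P : B12.RunParams, Nodes (leavesP w P) := fun P =>
  have h₁₂ := isRecordOfRecord₁₂C_of_isRecordOfRecord₁₂CB10YZW h
  have h3 := b9_b11_b15_main_of_isRecordOfRecord₁₂CB10YZW_of_slots h hYZW
  ⟨b4_main_of_isRecordOfRecord₁₂C h₁₂ P, b5_main_of_isRecordOfRecord₁₂C h₁₂ P, N24_b6_main_of_isRecordOfRecord₁₂C h₁₂ P, b7_main_of_isRecordOfRecord₁₂C h₁₂ P,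
    N24_b8_main_of_isRecordOfRecord₁₂C_of_slot h₁₂ slots₀₅ P, (h3 P).1, N24_b10_main_of_isRecordOfRecord₁₂CB10YZW_of_printedUV3V h hUV₀₈ P, (h3 P).2.1,
    N24_b12_main_of_isRecordOfRecord₁₂C_of_slots h₁₂ slot12 h11dom hres huniq P, N24_b13_main_of_isRecordOfRecord₁₂C_of_slot h₁₂ slots₁₀ P,
    N24_b14_main_of_isRecordOfRecord₁₂C_of_slot h₁₂ slot11 P, (h3 P).2.2, N24_b16_main_of_isRecordOfRecord₁₂C_of_slots h₁₂ slots₁₃ P⟩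

/-! ## §2. The closer's pointed form over the four-pin view, every child by name (N08 print-facing; N06 ∕ N07 ∕ N12 at CHOSEN layers) -/

/-- **N24 · THE THIRTEEN DAG NODES AT A WORLD BOUND TO THE FOUR-PIN VIEW, FROM THE CHILDREN AT THE PRESENTATION'S OWN OBJECTS AND THE CHOSEN LAYERS, EVERY CHILD BY NAME** (module 29's
`N24_nodes₁₂B10YZW_pointed_N09` with the Cor.-3 leaves `hcor3` ↦ (UV₁₂) `hUV`; N13 := dag-n13-a's construction-generic engine `B16NodeKnitRepTowerOfRecord.b16_main_at_repTowerOfRecord_along` at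
`coreOfRecord₁₂ θ` with the pin reading `N24_rOperation_iff_of_up_view₁₂B10YZW` — the bare-view one-liner is module 30's `b16_main_at_record₁₂`): **N05** `B8LeafR` at `θ.res.X P`; **N06** def-Y's
leaf `B9LeafX (Y9OfRecord N θ.toStage3Params M⋆ ops)`; **N07** `B11Leaf (Z11OfRecord F N ζ)`; **N08** THE PRINTED SENTENCE `PrintedUV3V N θ.L`; **N09** own leaf + [Balaban1985Variational] Thm 1
×3 at θ's level domains; **N10** the B13 socket at the view; **N11** (S1ᵀ); **N12** `B15Leaf (WOfRecord₁₂ F N θ λW P)`; **N13** (R₁₂) `hR` + (UV₁₂) `hUV` ((0.1) pointwise on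
`densOfRecord₁₀ θ.toStage9Params P k`, the world's own `(e₋, e₊)`, interval on `]0, w.γ]`); N01 ∕ N02 ∕ N04 def-T's transferred theorems, N03 module 23's.  THE HYPOTHESIS LIST IS «WHICH
CHILD BLOCKS `stub_nodes12` OVER THE FOUR-PIN VIEW», EVERY CHILD AT THE PRESENTATION'S OWN OBJECTS. [cite: Balaban1989LargeFieldII, Thm 1 p.355, (0.1) pp.355–356, p.387, p.391; Balaban1988Convergent, Thm 1 p.262, Theorem p.245, p.244, (2.18) p.257, Cor. 3 (2.50) p.264; Balaban1987RG1, Thm 1 p.259, Thm 3 p.264, Lemma 4 (3.53) p.280, (1.1)–(1.3) p.260; Balaban1985Variational, Thm 1 (8)–(10) p.279; Balaban1985RegularSpaces, Thms 2, 4, 8 pp.83–101; Balaban1985BackgroundPropagators, Thms 3.1–3.15 pp.397–432; Balaban1985UV3, (1)–(5) p.256, Thm 1 p.257 + Thm 2 p.272; Balaban1988RG2Cluster, Lemmas 1–3 pp.9, 11, 20; Balaban1989LargeFieldI, Prop. 1 p.194, (0.2)–(0.3) p.176 (node bookkeeping over the four-pin view)] -/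
theorem N24_nodes₁₂B10YZW_pointed_all (θ : Stage12Params F N) (hP : θ.Provisos₁₂ F N) (hθ : θ.Admissible F N)
    (Mstar : ℕ) (ops : OpsY N θ.toStage3Params Mstar) (ζ : ResidZ F N) (lamW : ResidW F N) (w : WorldP)
    (hC : w.C = (datumOfRecord₁₂ F N θ hP).C) (hγ : 0 < w.γ ∧ w.γ ≤ θ.γ) (hL : w.L = (θ.L : ℝ))
    (hup : ∀ P, w.up P = upOfRecord₅C F N (θ.view₁₂B10YZW F N Mstar ops ζ lamW) P)
    (h05 : ∀ P : B12.RunParams,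
      B8LeafR (θ.res.X P).d8 (θ.res.X P).L8 (θ.res.X P).C₂ (θ.res.X P).B₁' (θ.res.X P).B₀' (θ.res.X P).B₁ (θ.res.X P).B₂ (θ.res.X P).c₁
        (θ.res.X P).inp8 (θ.res.X P).B₀β (θ.res.X P).loc8 (θ.res.X P).fam8R (θ.res.X P).lan8 (θ.res.X P).cub8 (θ.res.X P).toAxial8)
    (h06 : B9LeafX (Y9OfRecord N θ.toStage3Params Mstar ops))
    (h07 : B11Leaf (Z11OfRecord F N ζ))
    (h08 : PrintedUV3V N θ.L)
    (h09 : ∀ P : B12.RunParams, B12Sec2to5.Lemma4Printed (θ.res.X P).F12 (θ.res.X P).c12)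
    (h11dom : ∀ (P : B12.RunParams) (k : ℕ), k ≤ P.K →
      ∀ V ∈ domAltOfRecord F N θ.ν P.K k, UkExists F N P.K k θ.εbg V ∧ UniqueUkOrbit F N P.K k θ.εbg V)
    (hres : ∀ (P : B12.RunParams) (k : ℕ), k ≤ P.K → HRestrict F N θ.εbg P.K k (domAltOfRecord F N θ.ν P.K k))
    (huniq : ∀ (P : B12.RunParams) (k : ℕ), k ≤ P.K → ∀ V ∈ domAltOfRecord F N θ.ν P.K k, ∀ j < k,
      UniqueUkOrbit F N P.K (j + 1) θ.εbg (Averaging.iter (avOfRecord F N P.K) (j + 1) (Uk F N P.K k θ.εbg V)))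
    (h10 : ∀ P : B12.RunParams, B9LeafX (Y9OfRecord N θ.toStage3Params Mstar ops) →
      (B10.Thm1PrintedCompact ((θ.view₁₂B10YZW F N Mstar ops ζ lamW).res.X P).runs10 ∧
          B10.Thm2Printed ((θ.view₁₂B10YZW F N Mstar ops ζ lamW).res.X P).runs10) →
        B11Leaf (Z11OfRecord F N ζ) → B12Sec2to5.Lemma4Printed (θ.res.X P).F12 (θ.res.X P).c12 →
          B13.Lemma1Printed (θ.res.X P).S13 (θ.res.X P).c13 ∧ B13.Lemma2Printed (θ.res.X P).S13 (θ.res.X P).c13 ∧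
            B13.Lemma3Printed (θ.res.X P).S13 (θ.res.X P).c13)
    (h11 : ∀ P : B12.RunParams, (leavesP w P).b7 → (leavesP w P).b8 → (leavesP w P).b9 → (leavesP w P).b10 → (leavesP w P).b11 →
      (leavesP w P).smallCouplings → (leavesP w P).smallFieldInductive → (leavesP w P).flowControl →
        ∀ k, k < P.K → SLaw₁₂ F N θ P k → TLaw₁₂ F N θ P k)
    (h12 : ∀ P : B12.RunParams, B15Leaf (WOfRecord₁₂ F N θ lamW P))
    (hR : ∀ (P : B12.RunParams) (k : ℕ), k < P.K → TLaw₁₂ F N θ P k → SLaw₁₂ F N θ P (k + 1))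
    (hUV : ∀ P : B12.RunParams, (genFlow (betaOfRecord₁₀ F N θ.toStage9Params) P.g0).InInterval w.γ P.K → ∀ k, k ≤ P.K → SLaw₁₂ F N θ P k →
      ∀ U : GaugeField (F.P P.K) k (SU N),
        chiFixed7 F N θ.ν P.K (gOfRecord₁₀ F N θ.toStage9Params P) k U *
              Real.exp (-(1 / (gOfRecord₁₀ F N θ.toStage9Params P k) ^ 2 * wilsonBGOfRecord F N θ.εbg P k U)
                - w.em (gOfRecord₁₀ F N θ.toStage9Params P k) * (Fintype.card (Site (F.P P.K) k) : ℝ)) ≤ densOfRecord₁₀ F N θ.toStage9Params P k U ∧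
        densOfRecord₁₀ F N θ.toStage9Params P k U ≤ Real.exp (w.ep (gOfRecord₁₀ F N θ.toStage9Params P k) * (Fintype.card (Site (F.P P.K) k) : ℝ))) :
    IsRecordOfRecord₁₂CB10YZW F N (datumOfRecord₁₂ F N θ hP) w ∧ IsRecordOfRecord₁₂C F N (datumOfRecord₁₂ F N θ hP) w ∧
      ∀ P : B12.RunParams, Nodes (leavesP w P) := by
  have hrec₄ : IsRecordOfRecord₁₂CB10YZW F N (datumOfRecord₁₂ F N θ hP) w := ⟨θ, hP, Mstar, ops, ζ, lamW, hθ, rfl, hC, hγ, hL, hup⟩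
  have hrec : IsRecordOfRecord₁₂C F N (datumOfRecord₁₂ F N θ hP) w := isRecordOfRecord₁₂C_of_isRecordOfRecord₁₂CB10YZW hrec₄
  refine ⟨hrec₄, hrec, fun P => ?_⟩
  have hl := upOfRecord₅C_view₁₂B10YZW_leaves F N θ Mstar ops ζ lamW P
  have h8 : (w.up P).b8 := by
    rw [hup P]; exact (B11LeafUnpinnedRecord.upOfRecord₅C_b8_b9_b11 (θ.view₁₂B10YZW F N Mstar ops ζ lamW) P).1.2 (h05 P)
  have h9 : (w.up P).b9 := by rw [hup P]; exact hl.2.1.2 h06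
  have h10leaf : (w.up P).b10 := by rw [hup P]; exact hl.2.2.1.2 h08
  have h11leaf : (w.up P).b11 := by rw [hup P]; exact hl.2.2.2.2 h07
  have h15 : (w.up P).rBasicStep := by rw [hup P]; exact hl.1.2 (h12 P)
  have h12leaf : (leavesP w P).b12 := by
    show (w.up P).b12
    rw [hup P]; exact h09 P
  exact ⟨b4_main_of_isRecordOfRecord₁₂C hrec P, b5_main_of_isRecordOfRecord₁₂C hrec P, N24_b6_main_of_isRecordOfRecord₁₂C hrec P,
    b7_main_of_isRecordOfRecord₁₂C hrec P, B8LeafKnit.b8_main_of_leaf w P h8, fun _ _ _ _ => h9, fun _ _ _ _ _ _ => h10leaf,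
    fun _ _ _ _ _ => h11leaf, B12NodeKnitRecord8.b12_main_of_leaf_of_thm3Member h12leaf
      (B12NodeKnitRecord12.thm3Member_stage12_of_hRestrict θ hP hC P (h11dom P) (hres P) (huniq P)),
    B13NodeKnitRecord5C.b13_main_at_stage5ParamsC F N (θ.view₁₂B10YZW F N Mstar ops ζ lamW) w P (hup P) (h10 P),
    B14NodeKnitRecord12R.b14_main_at_record₁₂_of_rOpLeaf F N θ hP w P hC
      (fun hrop => (rOpLeaf_VOfRecord₁₂_iff F N θ P).2 ((N24_rOperation_iff_of_up_view₁₂B10YZW θ Mstar ops ζ lamW (hup P)).1 hrop)) (h11 P),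
    B15LeafKnit.b15_main_of_up (U := w.up P) rfl h15,
    B16NodeKnitRepTowerOfRecord.b16_main_at_repTowerOfRecord_along F N (coreOfRecord₁₂ F N θ) w P θ.ν θ.τ9 (EOfRecord₁₀ F N θ.toStage9Params)
      (wOfRecord₉ F N θ.toStage9Params) θ.ppSel (gOfRecord₁₀ F N θ.toStage9Params) (fun k _ => SLaw₁₂ F N θ P k) (fun k _ => TLaw₁₂ F N θ P k)
      (hC.trans (datumOfRecord₁₂_C F N θ hP)) (fun _ _ => Iff.rfl) (N24_rOperation_iff_of_up_view₁₂B10YZW θ Mstar ops ζ lamW (hup P)).2 (hR P) le_rfl (hUV P)⟩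

/-- **THE BODY OF `NodesAtSomeRecord12` OVER THE FOUR-PIN VIEW, EVERY CHILD BY NAME** (general `N`; guard `hU` DISPLAYED — K0′'s product): witnesses `(θ, hP, w)` themselves.
[cite: Balaban1989LargeFieldII, Thm 1 p.355, (0.1) pp.355–356, p.391; Balaban1985UV3, Thm 1 p.257 + Thm 2 p.272; Balaban1987RG1, Thm 3 p.264; Balaban1985Variational, Thm 1 p.279; Balaban1988Convergent, Thm 1 p.262, Cor. 3 (2.50) p.264 (bookkeeping)] -/
theorem N24_nodesAtSomeRecord₁₂_of_fourPin_pointed_all (θ : Stage12Params F N) (hP : θ.Provisos₁₂ F N) (hθ : θ.Admissible F N)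
    (hU : θ.ZtUnity F N ∧ θ.SlotsNondegenerate)
    (Mstar : ℕ) (ops : OpsY N θ.toStage3Params Mstar) (ζ : ResidZ F N) (lamW : ResidW F N) (w : WorldP)
    (hC : w.C = (datumOfRecord₁₂ F N θ hP).C) (hγ : 0 < w.γ ∧ w.γ ≤ θ.γ) (hL : w.L = (θ.L : ℝ))
    (hup : ∀ P, w.up P = upOfRecord₅C F N (θ.view₁₂B10YZW F N Mstar ops ζ lamW) P)
    (h05 : ∀ P : B12.RunParams,
      B8LeafR (θ.res.X P).d8 (θ.res.X P).L8 (θ.res.X P).C₂ (θ.res.X P).B₁' (θ.res.X P).B₀' (θ.res.X P).B₁ (θ.res.X P).B₂ (θ.res.X P).c₁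
        (θ.res.X P).inp8 (θ.res.X P).B₀β (θ.res.X P).loc8 (θ.res.X P).fam8R (θ.res.X P).lan8 (θ.res.X P).cub8 (θ.res.X P).toAxial8)
    (h06 : B9LeafX (Y9OfRecord N θ.toStage3Params Mstar ops))
    (h07 : B11Leaf (Z11OfRecord F N ζ))
    (h08 : PrintedUV3V N θ.L)
    (h09 : ∀ P : B12.RunParams, B12Sec2to5.Lemma4Printed (θ.res.X P).F12 (θ.res.X P).c12)
    (h11dom : ∀ (P : B12.RunParams) (k : ℕ), k ≤ P.K →
      ∀ V ∈ domAltOfRecord F N θ.ν P.K k, UkExists F N P.K k θ.εbg V ∧ UniqueUkOrbit F N P.K k θ.εbg V)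
    (hres : ∀ (P : B12.RunParams) (k : ℕ), k ≤ P.K → HRestrict F N θ.εbg P.K k (domAltOfRecord F N θ.ν P.K k))
    (huniq : ∀ (P : B12.RunParams) (k : ℕ), k ≤ P.K → ∀ V ∈ domAltOfRecord F N θ.ν P.K k, ∀ j < k,
      UniqueUkOrbit F N P.K (j + 1) θ.εbg (Averaging.iter (avOfRecord F N P.K) (j + 1) (Uk F N P.K k θ.εbg V)))
    (h10 : ∀ P : B12.RunParams, B9LeafX (Y9OfRecord N θ.toStage3Params Mstar ops) →
      (B10.Thm1PrintedCompact ((θ.view₁₂B10YZW F N Mstar ops ζ lamW).res.X P).runs10 ∧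
          B10.Thm2Printed ((θ.view₁₂B10YZW F N Mstar ops ζ lamW).res.X P).runs10) →
        B11Leaf (Z11OfRecord F N ζ) → B12Sec2to5.Lemma4Printed (θ.res.X P).F12 (θ.res.X P).c12 →
          B13.Lemma1Printed (θ.res.X P).S13 (θ.res.X P).c13 ∧ B13.Lemma2Printed (θ.res.X P).S13 (θ.res.X P).c13 ∧
            B13.Lemma3Printed (θ.res.X P).S13 (θ.res.X P).c13)
    (h11 : ∀ P : B12.RunParams, (leavesP w P).b7 → (leavesP w P).b8 → (leavesP w P).b9 → (leavesP w P).b10 → (leavesP w P).b11 →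
      (leavesP w P).smallCouplings → (leavesP w P).smallFieldInductive → (leavesP w P).flowControl →
        ∀ k, k < P.K → SLaw₁₂ F N θ P k → TLaw₁₂ F N θ P k)
    (h12 : ∀ P : B12.RunParams, B15Leaf (WOfRecord₁₂ F N θ lamW P))
    (hR : ∀ (P : B12.RunParams) (k : ℕ), k < P.K → TLaw₁₂ F N θ P k → SLaw₁₂ F N θ P (k + 1))
    (hUV : ∀ P : B12.RunParams, (genFlow (betaOfRecord₁₀ F N θ.toStage9Params) P.g0).InInterval w.γ P.K → ∀ k, k ≤ P.K → SLaw₁₂ F N θ P k →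
      ∀ U : GaugeField (F.P P.K) k (SU N),
        chiFixed7 F N θ.ν P.K (gOfRecord₁₀ F N θ.toStage9Params P) k U *
              Real.exp (-(1 / (gOfRecord₁₀ F N θ.toStage9Params P k) ^ 2 * wilsonBGOfRecord F N θ.εbg P k U)
                - w.em (gOfRecord₁₀ F N θ.toStage9Params P k) * (Fintype.card (Site (F.P P.K) k) : ℝ)) ≤ densOfRecord₁₀ F N θ.toStage9Params P k U ∧
        densOfRecord₁₀ F N θ.toStage9Params P k U ≤ Real.exp (w.ep (gOfRecord₁₀ F N θ.toStage9Params P k) * (Fintype.card (Site (F.P P.K) k) : ℝ))) :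
    ∃ (θ' : Stage12Params F N) (h' : θ'.Provisos₁₂ F N) (w' : WorldP), (θ'.ZtUnity F N ∧ θ'.SlotsNondegenerate) ∧ θ'.Admissible F N ∧
      IsRecordOfRecord₁₂C F N (datumOfRecord₁₂ F N θ' h') w' ∧ ∀ P : B12.RunParams, Nodes (leavesP w' P) := by
  obtain ⟨-, hrec, hn⟩ := N24_nodes₁₂B10YZW_pointed_all θ hP hθ Mstar ops ζ lamW w hC hγ hL hup h05 h06 h07 h08 h09 h11dom hres huniq
    h10 h11 h12 hR hUV
  exact ⟨θ, hP, w, hU, hθ, hrec, hn⟩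

/-- **THE BODY OF `BetaWindowAtSomeRecord12` OVER THE FOUR-PIN VIEW, EVERY CHILD BY NAME, WITH THE β-BOX PAIR** `w.b ≤ (datumOfRecord₁₂ θ hP).βfun ≤ w.βup` on `]0, w.γ]^{k+1}` (upper:
[Balaban1987RG1] (1.22) p. 264, proof deferred in print; lower with `w.b > 0`: UNPRINTED, T09.F = NODE O): witnesses `(θ, hP, w)` themselves; interval and window by module 26 §2.
[cite: Balaban1987RG1, §1 (1.22) p.264, Thm 2 p.259, Thm 3 p.264, (0.17)–(0.20) pp.255–256; Balaban1985Variational, Thm 1 p.279; Balaban1985UV3, Thm 1 p.257; Balaban1989LargeFieldII, Thm 1 p.355, (0.1) pp.355–356 (bookkeeping)] -/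
theorem N24_betaWindowAtSomeRecord₁₂_of_fourPin_pointed_all_of_boxH (θ : Stage12Params F N) (hP : θ.Provisos₁₂ F N) (hθ : θ.Admissible F N)
    (hU : θ.ZtUnity F N ∧ θ.SlotsNondegenerate)
    (Mstar : ℕ) (ops : OpsY N θ.toStage3Params Mstar) (ζ : ResidZ F N) (lamW : ResidW F N) (w : WorldP)
    (hC : w.C = (datumOfRecord₁₂ F N θ hP).C) (hγ : 0 < w.γ ∧ w.γ ≤ θ.γ) (hL : w.L = (θ.L : ℝ))
    (hup : ∀ P, w.up P = upOfRecord₅C F N (θ.view₁₂B10YZW F N Mstar ops ζ lamW) P)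
    (h05 : ∀ P : B12.RunParams,
      B8LeafR (θ.res.X P).d8 (θ.res.X P).L8 (θ.res.X P).C₂ (θ.res.X P).B₁' (θ.res.X P).B₀' (θ.res.X P).B₁ (θ.res.X P).B₂ (θ.res.X P).c₁
        (θ.res.X P).inp8 (θ.res.X P).B₀β (θ.res.X P).loc8 (θ.res.X P).fam8R (θ.res.X P).lan8 (θ.res.X P).cub8 (θ.res.X P).toAxial8)
    (h06 : B9LeafX (Y9OfRecord N θ.toStage3Params Mstar ops))
    (h07 : B11Leaf (Z11OfRecord F N ζ))
    (h08 : PrintedUV3V N θ.L)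
    (h09 : ∀ P : B12.RunParams, B12Sec2to5.Lemma4Printed (θ.res.X P).F12 (θ.res.X P).c12)
    (h11dom : ∀ (P : B12.RunParams) (k : ℕ), k ≤ P.K →
      ∀ V ∈ domAltOfRecord F N θ.ν P.K k, UkExists F N P.K k θ.εbg V ∧ UniqueUkOrbit F N P.K k θ.εbg V)
    (hres : ∀ (P : B12.RunParams) (k : ℕ), k ≤ P.K → HRestrict F N θ.εbg P.K k (domAltOfRecord F N θ.ν P.K k))
    (huniq : ∀ (P : B12.RunParams) (k : ℕ), k ≤ P.K → ∀ V ∈ domAltOfRecord F N θ.ν P.K k, ∀ j < k,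
      UniqueUkOrbit F N P.K (j + 1) θ.εbg (Averaging.iter (avOfRecord F N P.K) (j + 1) (Uk F N P.K k θ.εbg V)))
    (h10 : ∀ P : B12.RunParams, B9LeafX (Y9OfRecord N θ.toStage3Params Mstar ops) →
      (B10.Thm1PrintedCompact ((θ.view₁₂B10YZW F N Mstar ops ζ lamW).res.X P).runs10 ∧
          B10.Thm2Printed ((θ.view₁₂B10YZW F N Mstar ops ζ lamW).res.X P).runs10) →
        B11Leaf (Z11OfRecord F N ζ) → B12Sec2to5.Lemma4Printed (θ.res.X P).F12 (θ.res.X P).c12 →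
          B13.Lemma1Printed (θ.res.X P).S13 (θ.res.X P).c13 ∧ B13.Lemma2Printed (θ.res.X P).S13 (θ.res.X P).c13 ∧
            B13.Lemma3Printed (θ.res.X P).S13 (θ.res.X P).c13)
    (h11 : ∀ P : B12.RunParams, (leavesP w P).b7 → (leavesP w P).b8 → (leavesP w P).b9 → (leavesP w P).b10 → (leavesP w P).b11 →
      (leavesP w P).smallCouplings → (leavesP w P).smallFieldInductive → (leavesP w P).flowControl →
        ∀ k, k < P.K → SLaw₁₂ F N θ P k → TLaw₁₂ F N θ P k)
    (h12 : ∀ P : B12.RunParams, B15Leaf (WOfRecord₁₂ F N θ lamW P))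
    (hR : ∀ (P : B12.RunParams) (k : ℕ), k < P.K → TLaw₁₂ F N θ P k → SLaw₁₂ F N θ P (k + 1))
    (hUV : ∀ P : B12.RunParams, (genFlow (betaOfRecord₁₀ F N θ.toStage9Params) P.g0).InInterval w.γ P.K → ∀ k, k ≤ P.K → SLaw₁₂ F N θ P k →
      ∀ U : GaugeField (F.P P.K) k (SU N),
        chiFixed7 F N θ.ν P.K (gOfRecord₁₀ F N θ.toStage9Params P) k U *
              Real.exp (-(1 / (gOfRecord₁₀ F N θ.toStage9Params P k) ^ 2 * wilsonBGOfRecord F N θ.εbg P k U)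
                - w.em (gOfRecord₁₀ F N θ.toStage9Params P k) * (Fintype.card (Site (F.P P.K) k) : ℝ)) ≤ densOfRecord₁₀ F N θ.toStage9Params P k U ∧
        densOfRecord₁₀ F N θ.toStage9Params P k U ≤ Real.exp (w.ep (gOfRecord₁₀ F N θ.toStage9Params P k) * (Fintype.card (Site (F.P P.K) k) : ℝ)))
    (hlo : BetaLowerH w.b w.γ (datumOfRecord₁₂ F N θ hP).βfun) (hhi : BetaUpperH w.βup w.γ (datumOfRecord₁₂ F N θ hP).βfun) :
    ∃ (θ' : Stage12Params F N) (h' : θ'.Provisos₁₂ F N) (w' : WorldP), (θ'.ZtUnity F N ∧ θ'.SlotsNondegenerate) ∧ θ'.Admissible F N ∧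
      IsRecordOfRecord₁₂C F N (datumOfRecord₁₂ F N θ' h') w' ∧ (∀ P : B12.RunParams, Nodes (leavesP w' P)) ∧
      BetaBoundsInInterval w'.C.toB12 w'.γ w'.b w'.βup ∧
      ∃ γ₁ : ℝ, 0 < γ₁ ∧ ∀ γ : ℝ, 0 < γ → γ ≤ γ₁ → ∃ P : B12.RunParams, 1 ≤ P.K ∧ ((datumOfRecord₁₂ F N θ' h').C P).flow.InInterval γ P.K := by
  obtain ⟨-, hrec, hn⟩ := N24_nodes₁₂B10YZW_pointed_all θ hP hθ Mstar ops ζ lamW w hC hγ hL hup h05 h06 h07 h08 h09 h11dom hres huniq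
    h10 h11 h12 hR hUV
  exact ⟨θ, hP, w, hU, hθ, hrec, hn, N24_betaBoundsInInterval_of_isRecordOfRecord₁₂C_of_boxH hrec hlo hhi,
    N24_window_of_betaUpperH _ hγ.1 hhi⟩

/-- **THE CONSEQUENT OF ITEM K1′ `StabilityBAtRecordR12e` (rev 15, stmt-QuantumFields-19903) OVER THE FOUR-PIN VIEW, EVERY CHILD BY NAME**, witnessed by `(θ, hP)`: (B) at
`(datumOfRecord₁₂ θ hP).C` by def-T's END headline at §2's nodes with the interval β-binder from the box pair, the window from `hhi` (module 26 §2); guard `hU` DISPLAYED.  THE CLOSER'S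
RECIPE OVER THE FOUR-PIN VIEW: a guarded admissible presentation (K0′), chosen layers `(M⋆, ops, ζ, λW)` with def-Y's ∕ [B11]'s ∕ [IV]'s leaves, the PRINTED [B10] sentence at `θ.L`, N05's
residual [B8] leaf, N09's Lemma-4 leaf + [B11] Thm 1 ×3, N10's B13 socket, N11's (S1ᵀ), N13's (R₁₂) law transport + (UV₁₂) (0.1) pointwise, and the β-box pair (β⁺ [I] p. 264; `b > 0` NODE O,
UNPRINTED).  COMPOSITE: nothing is discharged. [cite: Balaban1989LargeFieldII, Thm 1 p.355, (0.1) pp.355–356, p.391; Balaban1988Convergent, (3.16)–(3.22) pp.268–269; Balaban1987RG1, Thm 3 p.264, (0.17)–(0.20) pp.255–256 and (1.22) p.264; Balaban1985UV3, Thm 1 p.257 + Thm 2 p.272; Balaban1985Variational, Thm 1 p.279 (bookkeeping + elementary window)] -/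
theorem N24_stabilityBR12e_thetaShape15_fourPin_pointed_all (θ : Stage12Params F N) (hP : θ.Provisos₁₂ F N) (hθ : θ.Admissible F N)
    (hU : θ.ZtUnity F N ∧ θ.SlotsNondegenerate)
    (Mstar : ℕ) (ops : OpsY N θ.toStage3Params Mstar) (ζ : ResidZ F N) (lamW : ResidW F N) (w : WorldP)
    (hC : w.C = (datumOfRecord₁₂ F N θ hP).C) (hγ : 0 < w.γ ∧ w.γ ≤ θ.γ) (hL : w.L = (θ.L : ℝ))
    (hup : ∀ P, w.up P = upOfRecord₅C F N (θ.view₁₂B10YZW F N Mstar ops ζ lamW) P)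
    (h05 : ∀ P : B12.RunParams,
      B8LeafR (θ.res.X P).d8 (θ.res.X P).L8 (θ.res.X P).C₂ (θ.res.X P).B₁' (θ.res.X P).B₀' (θ.res.X P).B₁ (θ.res.X P).B₂ (θ.res.X P).c₁
        (θ.res.X P).inp8 (θ.res.X P).B₀β (θ.res.X P).loc8 (θ.res.X P).fam8R (θ.res.X P).lan8 (θ.res.X P).cub8 (θ.res.X P).toAxial8)
    (h06 : B9LeafX (Y9OfRecord N θ.toStage3Params Mstar ops))
    (h07 : B11Leaf (Z11OfRecord F N ζ))
    (h08 : PrintedUV3V N θ.L)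
    (h09 : ∀ P : B12.RunParams, B12Sec2to5.Lemma4Printed (θ.res.X P).F12 (θ.res.X P).c12)
    (h11dom : ∀ (P : B12.RunParams) (k : ℕ), k ≤ P.K →
      ∀ V ∈ domAltOfRecord F N θ.ν P.K k, UkExists F N P.K k θ.εbg V ∧ UniqueUkOrbit F N P.K k θ.εbg V)
    (hres : ∀ (P : B12.RunParams) (k : ℕ), k ≤ P.K → HRestrict F N θ.εbg P.K k (domAltOfRecord F N θ.ν P.K k))
    (huniq : ∀ (P : B12.RunParams) (k : ℕ), k ≤ P.K → ∀ V ∈ domAltOfRecord F N θ.ν P.K k, ∀ j < k,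
      UniqueUkOrbit F N P.K (j + 1) θ.εbg (Averaging.iter (avOfRecord F N P.K) (j + 1) (Uk F N P.K k θ.εbg V)))
    (h10 : ∀ P : B12.RunParams, B9LeafX (Y9OfRecord N θ.toStage3Params Mstar ops) →
      (B10.Thm1PrintedCompact ((θ.view₁₂B10YZW F N Mstar ops ζ lamW).res.X P).runs10 ∧
          B10.Thm2Printed ((θ.view₁₂B10YZW F N Mstar ops ζ lamW).res.X P).runs10) →
        B11Leaf (Z11OfRecord F N ζ) → B12Sec2to5.Lemma4Printed (θ.res.X P).F12 (θ.res.X P).c12 →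
          B13.Lemma1Printed (θ.res.X P).S13 (θ.res.X P).c13 ∧ B13.Lemma2Printed (θ.res.X P).S13 (θ.res.X P).c13 ∧
            B13.Lemma3Printed (θ.res.X P).S13 (θ.res.X P).c13)
    (h11 : ∀ P : B12.RunParams, (leavesP w P).b7 → (leavesP w P).b8 → (leavesP w P).b9 → (leavesP w P).b10 → (leavesP w P).b11 →
      (leavesP w P).smallCouplings → (leavesP w P).smallFieldInductive → (leavesP w P).flowControl →
        ∀ k, k < P.K → SLaw₁₂ F N θ P k → TLaw₁₂ F N θ P k)
    (h12 : ∀ P : B12.RunParams, B15Leaf (WOfRecord₁₂ F N θ lamW P))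
    (hR : ∀ (P : B12.RunParams) (k : ℕ), k < P.K → TLaw₁₂ F N θ P k → SLaw₁₂ F N θ P (k + 1))
    (hUV : ∀ P : B12.RunParams, (genFlow (betaOfRecord₁₀ F N θ.toStage9Params) P.g0).InInterval w.γ P.K → ∀ k, k ≤ P.K → SLaw₁₂ F N θ P k →
      ∀ U : GaugeField (F.P P.K) k (SU N),
        chiFixed7 F N θ.ν P.K (gOfRecord₁₀ F N θ.toStage9Params P) k U *
              Real.exp (-(1 / (gOfRecord₁₀ F N θ.toStage9Params P k) ^ 2 * wilsonBGOfRecord F N θ.εbg P k U)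
                - w.em (gOfRecord₁₀ F N θ.toStage9Params P k) * (Fintype.card (Site (F.P P.K) k) : ℝ)) ≤ densOfRecord₁₀ F N θ.toStage9Params P k U ∧
        densOfRecord₁₀ F N θ.toStage9Params P k U ≤ Real.exp (w.ep (gOfRecord₁₀ F N θ.toStage9Params P k) * (Fintype.card (Site (F.P P.K) k) : ℝ)))
    (hlo : BetaLowerH w.b w.γ (datumOfRecord₁₂ F N θ hP).βfun) (hhi : BetaUpperH w.βup w.γ (datumOfRecord₁₂ F N θ hP).βfun) :
    ∃ (θ' : Stage12Params F N) (h' : θ'.Provisos₁₂ F N), (θ'.ZtUnity F N ∧ θ'.SlotsNondegenerate) ∧ θ'.Admissible F N ∧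
      B16.EndStatementBPrinted (datumOfRecord₁₂ F N θ' h').C ∧
      ∃ γ₁ : ℝ, 0 < γ₁ ∧ ∀ γ : ℝ, 0 < γ → γ ≤ γ₁ → ∃ P : B12.RunParams, 1 ≤ P.K ∧ ((datumOfRecord₁₂ F N θ' h').C P).flow.InInterval γ P.K := by
  obtain ⟨-, hrec, hn⟩ := N24_nodes₁₂B10YZW_pointed_all θ hP hθ Mstar ops ζ lamW w hC hγ hL hup h05 h06 h07 h08 h09 h11dom hres huniq
    h10 h11 h12 hR hUV
  exact ⟨θ, hP, hU, hθ, endStatementBPrinted_of_isRecordOfRecord₁₂C_of_nodes hrec le_rfl hn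
    (N24_betaBoundsInInterval_of_isRecordOfRecord₁₂C_of_boxH hrec hlo hhi), N24_window_of_betaUpperH _ hγ.1 hhi⟩

end Literature.MathematicalPhysics.QuantumFieldTheory.Balaban1983to89.Node00

end
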